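import Literature.IUT.HodgeArakelov.ThetaEvaluationModelEvPointed
import Literature.IUT.HodgeArakelov.CohomologyLimitKummerTorsion
import Literature.AnabelianGeometry.AbsoluteAnabelian.MonoidKummerMapsUnitPairProofs
import Literature.AnabelianGeometry.AbsoluteAnabelian.GaloisPadicLogPerfection

/-!
# [IUTchII] Cor. 1.12 (ii) at the model: the input `hμ` ("torsion classes on `D_{μ_-}` are unit classes",
# Kummer theory of MLF) DISCHARGED — proof companion

Proof-only companion (abc-iut cell, D-0068 wave 5, seat abc-iut-w5-d205 gen 3; GAP-LEDGER row `G-w4d043-1`,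
node **IUTchII:Cor1.12(ii)**, SUBDAG `plan/L6/SUBDAG-IUTchII-Cor-112.md` row Cor-112.ii.r13) to abc-iut-w4-d043's
`ThetaEvaluationModelEvInstance.lean` / `ThetaEvaluationModelEvProofs.lean` / `ThetaEvaluationModelEvPointed.lean`
(the model theta-evaluation datum `EtaleLevels.thetaEvaluation` and [IUTchII] Cor. 1.12 (ii) for it) and to
abc-iut-w5-d098's `CohomologyLimitKummerTorsion.lean` (torsion classes of `lim_K H¹(H ⊓ K, A')` are Kummer classes
of roots of unity, p419249). No definitions; nothing of abc-iut-w4-d043's files is restated.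

S. Mochizuki, *Inter-universal Teichmüller theory II*, kurims manuscript (Dec. 2020), Cor. 1.12 (ii) p. 57 and (d)
p. 56: "`M^μ_TM(−) ⊆ M^×_TM(−)` denotes the submodule of torsion elements". Claim key `Mochizuki2012` (D-0012,
DISPUTED); the content added here is classical Kummer theory of `p`-adic local fields
[cite: NeukirchSchmidtWingberg2008, II §7] (the torsion of `H¹(G_{k′}, Ẑ(1)) = (k′ˣ)^∧` is `μ(k′) ⊆ 𝒪^×_{k′}`);
nothing here takes a side on [IUTchIII] Cor. 3.12.

WHAT IS DISCHARGED. In every form of Cor. 1.12 (ii) at the model (`cor112_ii_thetaEvaluation`, `…_of_pair`,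
`…_units`, `…_units_H1`, `cor112_ii_model`) the input
`hμ : ∀ y : lim_K H¹(D_{μ_-}|_K, (l·Δ_Θ)), IsOfFinAddOrder y → y ∈ M^×_TM(Π)` (GAP `G-w4d043-1`; recorded there as a
FACT-level binder "Kummer theory of MLF") HOLDS as soon as
* `hc : Function.Bijective c.hom` — the change-of-coefficients cyclotome `c : Λ(k̄ˣ) = Ẑ(1) → (l·Δ_Θ)(Π)` is an
  ISOMORPHISM (the cyclotomic rigidity isomorphism of Cor. 1.11 (a) through which `M^×_TM(Π)` is defined; the same
  hypothesis shape as abc-iut-w4-d007's `h1LimRestrict_PiYdd_injective_of_coeff`), and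
* `hU : ∀ u, IsOfFinOrder u → u ∈ U` — the subgroup of constants `U` (print: `𝒪^×_{k̄}`) contains the roots of unity;
and the second input is a THEOREM for print's `U = 𝒪^×_{k̄}`: roots of unity are units of the ring of integers
(abc-iut-L4's `MLFClosure.mem_unitSubmonoid_of_pow_eq_one`, read on abc-iut-L4's subgroup `unitGroup k k̄ ≤ k̄ˣ`).

PROVED:
* `EtaleLevels.mem_thetaEvaluation_MxTM_of_isOfFinAddOrder` — `hμ` for the model datum from `hc` + `hU`
  (abc-iut-w5-d098's `exists_mem_h1LimKummer_eq_of_isOfFinAddOrder` read through abc-iut-w4-d043's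
  `mem_thetaEvaluation_MxTM`);
* `unitGroup_mem_of_isOfFinOrder` — for ANY `MLFClosure` `M` ([AbsTopIII] Def. 3.1 (i)), every torsion element of
  `M.Kˣ = k̄ˣ` lies in `unitGroup M.k M.K = 𝒪^×_{k̄}`; `mem_unitGroup_padic_of_isOfFinOrder` — the instance
  `k̄ = ℚ̄_p = PadicAlgCl p`;
* **`EtaleLevels.cor112_ii_thetaEvaluation_of_bijective`** — Cor. 1.12 (ii) for the model datum with `hμ` replaced
  by `hc` + `hU` (generic constants `Aroot ⊇ U`, generic retractions and `iotaLim`);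
* **`EtaleLevels.cor112_ii_model_of_bijective`** — abc-iut-w4-d043's fully concrete `cor112_ii_model` (model pointed
  inversion, canonical retractions of `ε`, constants `ℚ̄_pˣ ⊇ Uu`) with `hμ` replaced by `hcU` + `hUu`;
* **`EtaleLevels.cor112_ii_model_unitGroup`** — the same at print's `Uu := 𝒪^×_{ℚ̄_p} = unitGroup ℚ_[p] (PadicAlgCl p)`:
  `hμ` GONE; the residual named inputs of Cor. 1.12 (ii) at the model are the Rmk. 1.4.1 (ii) data of the pointed
  inversion, the decomposition-group facts `hDq`/`hlift`/`hemb`, `hα`/`hβ`, the cyclotome fixed-point fact `hfix`,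
  the Prop. 2.2 (ii) translate inputs (R1)–(R3), and `hcU` (bijectivity of the cyclotomic rigidity datum).
Typed ≠ discharged for those inputs.
-/

noncomputable section

namespace Literature.IUT.HodgeArakelov

open Literature.AnabelianGeometry.EtaleTheta Literature.AnabelianGeometry.SemiGraphs CohomologySystemOfContH1
open Literature.AnabelianGeometry.AbsoluteAnabelian
open scoped Literature.AnabelianGeometry.EtaleTheta

/-! ### Roots of unity are units of the ring of integers (classical) -/

/-- **Roots of unity of `k̄` lie in `𝒪^×_{k̄}`**: for any `MLFClosure` `M` ([AbsTopIII] Def. 3.1 (i): `k` an MLF,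
`k̄` an algebraic closure) every element of finite order of `k̄ˣ` belongs to abc-iut-L4's subgroup
`unitGroup M.k M.K = 𝒪^×_{k̄} ≤ k̄ˣ` (a root of `Xⁿ − 1` is integral over `𝒪_k`, with inverse `u^{n-1}`:
abc-iut-L4's `MLFClosure.mem_unitSubmonoid_of_pow_eq_one`). [cite: MochizukiAbsTopIII2015, Definition 3.1 (i) p.66] -/
theorem unitGroup_mem_of_isOfFinOrder (M : MLFClosure.{0}) {u : (M.K)ˣ} (hu : IsOfFinOrder u) :
    u ∈ unitGroup M.k M.K := by
  obtain ⟨n, hn, hun⟩ := hu.exists_pow_eq_one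
  exact (mem_unitGroup_iff u).mpr (MLFClosure.mem_unitSubmonoid_of_pow_eq_one M (u : M.K) n hn
    (by rw [← Units.val_pow_eq_pow_val, hun, Units.val_one]))

/-- The instance `k = ℚ_p`, `k̄ = ℚ̄_p = PadicAlgCl p` (abc-iut-L4's model `MLFClosure.padic p` = the reducible
`padicMLF p` of abc-iut-w4-d007): every root of unity of `ℚ̄_pˣ` lies in `𝒪^×_{ℚ̄_p} = unitGroup ℚ_[p] (PadicAlgCl p)`
— the torsion of the constants is contained in print's `U = 𝒪^×_{k̄}` (the hypothesis `hU` below, for that `U`).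
[cite: MochizukiAbsTopIII2015, Definition 3.1 (i) p.66] -/
theorem mem_unitGroup_padic_of_isOfFinOrder {p : ℕ} [Fact p.Prime] {u : (PadicAlgCl p)ˣ} (hu : IsOfFinOrder u) :
    u ∈ unitGroup ℚ_[p] (PadicAlgCl p) :=
  unitGroup_mem_of_isOfFinOrder (padicMLF p) hu

namespace EtaleLevels

variable {p : ℕ} [Fact p.Prime] {D : Literature.AnabelianGeometry.EtaleTheta.ThetaSetting p}
  {E : D.EtaleThetaData} {l : ℕ} (C : E.DoubleUnderline l) (hC : D.Compat) (hS : D.Sec2Hyps)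
  (hl : l.Prime) (hp2 : p ≠ 2) (hpl : p ≠ l) (hζ : ∃ ζ : D.K, IsPrimitiveRoot ζ (4 * l))
  (mods : ∀ M : ℕ+, D.CyclotomeMod l M)
  (f : contCocycles D.toTheta D.DeltaTheta C.GtpYdduu) (hf : f ∈ C.rootCocycles hC)
  (hmods : ∀ (M M' : ℕ+) (h : (M : ℕ) ∣ (M' : ℕ)) (x : D.lDeltaTheta l),
    MuN.red p M M' h ((mods M').red x) = (mods M).red x)
  (h15 : Literature.AnabelianGeometry.EtaleTheta.ThetaSetting.Prop15iii E hC) (L : C.CuspLabels)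
  (hZ : ∀ M : ℕ+, Nonempty (ModelCyclotomes.lDeltaQuot (C.rigidData (mods M) hC hS h15 L) ≃*
    Literature.IUT.HodgeTheaters.ZHat))
  (hcharY : EtaleThetaDataOfSetting.PiYddCharacteristic C)
  (hlim : Function.Bijective (rigidLimHom C hC hS hl hp2 hpl hζ mods f hf hmods h15 L hZ))
  (Env : EnvOfGroup (setting C hC hS hl hp2 hpl hζ mods f hf)
    (modelSystem C hC hS hl hp2 hpl hζ mods f hf hmods h15 L hZ).PiX)

/-! ### `hμ` for the model theta-evaluation datum from the bijectivity of the cyclotome coefficients -/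

section Generic

variable (I : PointedInversion Env (thetaEnvData C hC hS hl hp2 hpl hζ mods f hf hmods h15 L hZ hcharY hlim).D)
  (R : LevelRetraction (EtaleThetaDataOfSetting.phi C) (D.lDeltaTheta l) (EtaleThetaDataOfSetting.PiYdd C) I.Dmu)
  {Aroot : Type} [CommGroup Aroot] [MulDistribMulAction (EtaleThetaDataOfSetting.Pi C) Aroot]
  [TopologicalSpace Aroot] [RootableBy Aroot ℕ]
  (c : CyclotomeCoefficients (EtaleThetaDataOfSetting.phi C) (D.lDeltaTheta l) Aroot)
  (hA : ∀ b : Aroot, IsOpen (MulAction.stabilizer (EtaleThetaDataOfSetting.Pi C) b :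
    Set (EtaleThetaDataOfSetting.Pi C)))
  (hfi : ∀ b : Aroot, (MulAction.stabilizer (EtaleThetaDataOfSetting.Pi C) b).FiniteIndex)
  (U : Subgroup Aroot)
  (ρlim : (EtaleThetaDataOfSetting.coh C).lim ≃+ (EtaleThetaDataOfSetting.coh C).lim)

/-- **The input `hμ` of [IUTchII] Cor. 1.12 (ii) HOLDS for the model theta-evaluation datum** `EtaleLevels.thetaEvaluation …`
(`M^×_TM(Π) :=` the Kummer image of the constants `U ≤ Aroot` in `lim_K H¹(D_{μ_-}|_K, (l·Δ_Θ)(Π))`): every TORSION class of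
`lim_K H¹(D_{μ_-}|_K, (l·Δ_Θ)(Π))` lies in `M^×_TM(Π)`, provided the change-of-coefficients cyclotome
`c : Λ(Aroot) → (l·Δ_Θ)(Π)` is bijective (the cyclotomic rigidity isomorphism of Cor. 1.11 (a)) and `U` contains the roots
of unity of `Aroot` (print: `U = 𝒪^×_{k̄} ⊇ μ(k̄)`; Cor. 1.12 (d): "`M^μ_TM(−) ⊆ M^×_TM(−)` denotes the submodule of torsion
elements"). Kummer theory of MLF: abc-iut-w5-d098's `exists_mem_h1LimKummer_eq_of_isOfFinAddOrder`.
[claim: Mochizuki2012, status: disputed] (IUTchII §1 Cor 1.12 (ii), kurims pp.56-57) -/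
theorem mem_thetaEvaluation_MxTM_of_isOfFinAddOrder (hc : Function.Bijective c.hom)
    (hU : ∀ u : Aroot, IsOfFinOrder u → u ∈ U)
    (y : h1Lim (EtaleThetaDataOfSetting.phi C) (D.lDeltaTheta l) I.Dmu ⊥) (hy : IsOfFinAddOrder y) :
    y ∈ (thetaEvaluation C hC hS hl hp2 hpl hζ mods f hf hmods h15 L hZ hcharY hlim Env I R c hA hfi U ρlim).MxTM :=
  (mem_thetaEvaluation_MxTM C hC hS hl hp2 hpl hζ mods f hf hmods h15 L hZ hcharY hlim Env I R c hA hfi U ρlim y).mpr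
    (CohomologySystemOfContH1.exists_mem_h1LimKummer_eq_of_isOfFinAddOrder (EtaleThetaDataOfSetting.phi C)
      (D.lDeltaTheta l) I.Dmu c hA hfi hc U hU y hy)

/-- **[IUTchII] Cor. 1.12 (ii) for the MODEL theta-evaluation datum, `hμ` discharged**: abc-iut-w4-d043's
`cor112_ii_thetaEvaluation` with the input `hμ` (torsion classes on `D_{μ_-}` are unit classes; GAP `G-w4d043-1`) REPLACED
by `hc` (the cyclotome coefficients `c : Λ(Aroot) → (l·Δ_Θ)(Π)` are bijective — Cor. 1.11 (a)) and `hU` (`U` contains the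
roots of unity). Remaining inputs as there: `hι`, the Prop. 2.2 (ii) translate inputs `τ`/`hτ`/`hdesc`/`hrev`/`hfree`, `hres`.
[claim: Mochizuki2012, status: disputed] (IUTchII §1 Cor 1.12 (ii), kurims pp.57-58) -/
theorem cor112_ii_thetaEvaluation_of_bijective (hc : Function.Bijective c.hom)
    (hU : ∀ u : Aroot, IsOfFinOrder u → u ∈ U)
    (hι : ∀ m ∈ (thetaEvaluation C hC hS hl hp2 hpl hζ mods f hf hmods h15 L hZ hcharY hlim Env I R c hA hfi U
        ρlim).MxTM,
      IsOfFinAddOrder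
        ((thetaEvaluation C hC hS hl hp2 hpl hζ mods f hf hmods h15 L hZ hcharY hlim Env I R c hA hfi U ρlim).iotaLim
            ((thetaEvaluation C hC hS hl hp2 hpl hζ mods f hf hmods h15 L hZ hcharY hlim Env I R c hA hfi U
              ρlim).inclHd m) -
          (thetaEvaluation C hC hS hl hp2 hpl hζ mods f hf hmods h15 L hZ hcharY hlim Env I R c hA hfi U
            ρlim).inclHd m))
    (τ : ℤ → (EtaleThetaDataOfSetting.coh C).H1 ⊤) (hτ : τ 0 = I.etaStd)
    (hdesc : ∀ o ∈ EtaleThetaDataOfSetting.orbitOne C hC,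
      ∃ (n : ℤ) (c' : (EtaleThetaDataOfSetting.coh C).H1 ⊤), 2 • c' = 0 ∧ o = τ n + c')
    (hrev : ∀ n : ℤ, IsOfFinAddOrder (ρlim ((EtaleThetaDataOfSetting.coh C).toLim ⊤ (τ n)) -
      (EtaleThetaDataOfSetting.coh C).toLim ⊤ (τ (-n))))
    (hfree : ∀ m n : ℤ, IsOfFinAddOrder ((EtaleThetaDataOfSetting.coh C).toLim ⊤ (τ m) -
      (EtaleThetaDataOfSetting.coh C).toLim ⊤ (τ n)) → m = n)
    (hres : ∀ x : (EtaleThetaDataOfSetting.coh C).H1 ⊤, IsOfFinAddOrder (I.resDmu x) →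
      IsOfFinAddOrder (h1LimRestrict (EtaleThetaDataOfSetting.phi C) (D.lDeltaTheta l) I.Dmu_le ⊥
        ((EtaleThetaDataOfSetting.coh C).toLim ⊤ x))) :
    Literature.IUT.HodgeArakelov.Cor112_ii
      (thetaEvaluation C hC hS hl hp2 hpl hζ mods f hf hmods h15 L hZ hcharY hlim Env I R c hA hfi U ρlim) :=
  cor112_ii_thetaEvaluation C hC hS hl hp2 hpl hζ mods f hf hmods h15 L hZ hcharY hlim Env I R c hA hfi U ρlim hι
    (mem_thetaEvaluation_MxTM_of_isOfFinAddOrder C hC hS hl hp2 hpl hζ mods f hf hmods h15 L hZ hcharY hlim Env I R c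
      hA hfi U ρlim hc hU)
    τ hτ hdesc hrev hfree hres

end Generic

/-! ### The fully concrete instance: model pointed inversion, canonical retractions, constants `ℚ̄_pˣ` -/

section Model

variable
  -- the model pointed inversion (abc-iut-w5-d072's `pointedInversionOfPair`): its named print inputs
  (α : (EtaleThetaDataOfSetting.Pi C) ≃ₜ* (EtaleThetaDataOfSetting.Pi C))
  (hover : ∀ x : EtaleThetaDataOfSetting.Pi C, Env.recon.projG (Env.isoX (α x)) = Env.recon.projG (Env.isoX x))
  (δ : EtaleThetaDataOfSetting.Pi C) (hδ : Env.recon.projG (Env.isoX δ) = 1)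
  (hαα : ∀ x : EtaleThetaDataOfSetting.Pi C, α (α x) = δ * x * δ⁻¹)
  (γ : EtaleThetaDataOfSetting.Pi C) (hγ : C.toLZ γ = Multiplicative.ofAdd 1)
  (hαγ : C.toLZ (α γ) = Multiplicative.ofAdd (-1))
  (huniq : ∀ κ : (EtaleThetaDataOfSetting.Pi C) ≃ₜ* (EtaleThetaDataOfSetting.Pi C),
    (∀ x, Env.recon.projG (Env.isoX (κ x)) = Env.recon.projG (Env.isoX x)) →
    (∃ δ' : EtaleThetaDataOfSetting.Pi C, Env.recon.projG (Env.isoX δ') = 1 ∧ ∀ x, κ (κ x) = δ' * x * δ'⁻¹) →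
    (¬ ∃ δ' : EtaleThetaDataOfSetting.Pi C, Env.recon.projG (Env.isoX δ') = 1 ∧ ∀ x, κ x = δ' * x * δ'⁻¹) →
      ∃ δ' : EtaleThetaDataOfSetting.Pi C, Env.recon.projG (Env.isoX δ') = 1 ∧ ∀ x, κ x = δ' * α x * δ'⁻¹)
  (Dmu : Subgroup (EtaleThetaDataOfSetting.Pi C)) (hDmu : Dmu ≤ EtaleThetaDataOfSetting.PiYdd C)
  (hfixD : ∃ δ' : ↥(EtaleThetaDataOfSetting.PiYdd C), Env.recon.projG (Env.isoX (δ' : EtaleThetaDataOfSetting.Pi C)) = 1 ∧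
    ∀ (d : EtaleThetaDataOfSetting.Pi C) (hd : d ∈ Dmu), ((EtaleThetaDataOfSetting.iotaYddOfAut C hcharY α ⟨d, hDmu hd⟩ :
      EtaleThetaDataOfSetting.PiYdd C) : EtaleThetaDataOfSetting.Pi C) ∈
        Dmu.map (MulAut.conj ((δ' : EtaleThetaDataOfSetting.PiYdd C) : EtaleThetaDataOfSetting.Pi C)).toMonoidHom)
  (etaStd : (EtaleThetaDataOfSetting.coh C).H1 ⊤) (hmem : etaStd ∈ EtaleThetaDataOfSetting.orbitOne C hC)
  (hstd : (2 * (setting C hC hS hl hp2 hpl hζ mods f hf).l) • EtaleThetaDataOfSetting.resDmuOf C Dmu hDmu etaStd = 0)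
  -- the coefficient half of the pair and its printed properties
  (β : D.GtpTheta ≃ₜ* D.GtpTheta)
  (hφ : ∀ g, β (EtaleThetaDataOfSetting.phi C g) = EtaleThetaDataOfSetting.phi C (α g))
  (hAβ : ∀ a : D.GtpTheta, a ∈ D.lDeltaTheta l ↔ β a ∈ D.lDeltaTheta l)
  (hH : ∀ x, x ∈ EtaleThetaDataOfSetting.PiYdd C ↔ α x ∈ EtaleThetaDataOfSetting.PiYdd C)
  -- decomposition-group facts, constants
  (hDq : ∀ d ∈ Dmu, EtaleThetaDataOfSetting.aug C d = 1 → d = 1)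
  (hlift : ∀ K : Subgroup (EtaleThetaDataOfSetting.Pi C), K.FiniteIndex → IsOpen (K : Set (EtaleThetaDataOfSetting.Pi C)) →
    (liftSubgroup (EtaleThetaDataOfSetting.aug C) Dmu K).FiniteIndex ∧
      IsOpen (liftSubgroup (EtaleThetaDataOfSetting.aug C) Dmu K : Set (EtaleThetaDataOfSetting.Pi C)))
  (hemb : ∀ K : Subgroup (EtaleThetaDataOfSetting.Pi C),
    Topology.IsEmbedding fun d : ↥(Dmu ⊓ K) => EtaleThetaDataOfSetting.aug C d.1)
  (cU : CyclotomeCoefficients (EtaleThetaDataOfSetting.phi C) (D.lDeltaTheta l) (PadicAlgCl p)ˣ)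

/-- **[IUTchII] Cor. 1.12 (ii) at the model for the MODEL POINTED INVERSION, `hμ` discharged**: abc-iut-w4-d043's
`cor112_ii_model` (over `Π := Π^tp_{X̲̲}`, REAL continuous cohomology of `(l·Δ_Θ)`, abc-iut-w5-d072's `pointedInversionOfPair`,
the canonical retractions of `ε`, constants `ℚ̄_pˣ ⊇ Uu` acted on through `ε`, `iotaLim := pairRhoLim (α, β)`) with the input
`hμ` ("torsion classes on `D_{μ_-}` are unit classes", GAP `G-w4d043-1`) REPLACED by `hcU` (the cyclotome coefficients
`cU : Λ(ℚ̄_pˣ) = Ẑ(1) → (l·Δ_Θ)` are bijective — the cyclotomic rigidity isomorphism of Cor. 1.11 (a)) and `hUu` (`Uu` contains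
the roots of unity of `ℚ̄_p`). Remaining named print inputs exactly as in `cor112_ii_model`: the Rmk. 1.4.1 (ii) data,
`hDq`/`hlift`/`hemb`, `hα`/`hβ`, `hfix`, and the Prop. 2.2 (ii) translate inputs `τ`/`hτ`/`hdesc`/`hrev`/`hfree`.
[claim: Mochizuki2012, status: disputed] (IUTchII §1 Cor 1.12 (ii), kurims pp.56-58) -/
theorem cor112_ii_model_of_bijective (Uu : Subgroup (PadicAlgCl p)ˣ) (hcU : Function.Bijective cU.hom)
    (hUu : ∀ u : (PadicAlgCl p)ˣ, IsOfFinOrder u → u ∈ Uu)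
    (hα : ∀ x, EtaleThetaDataOfSetting.aug C (α x) = EtaleThetaDataOfSetting.aug C x)
    (hβ : ∀ a : D.GtpTheta, a ∈ D.lDeltaTheta l → β a = a)
    (hfix : ∀ K' : Subgroup (EtaleThetaDataOfSetting.Pi C), K'.FiniteIndex →
      ∀ a : D.lDeltaTheta l, (∀ n : EtaleThetaDataOfSetting.Pi C, n ∈ EtaleThetaDataOfSetting.PiYdd C ⊓ K' →
        MulAut.conjNormal (EtaleThetaDataOfSetting.phi C n) a = a) → a = 1)
    (τ : ℤ → (EtaleThetaDataOfSetting.coh C).H1 ⊤) (hτ : τ 0 = etaStd)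
    (hdesc : ∀ o ∈ EtaleThetaDataOfSetting.orbitOne C hC,
      ∃ (n : ℤ) (c' : (EtaleThetaDataOfSetting.coh C).H1 ⊤), 2 • c' = 0 ∧ o = τ n + c')
    (hrev : ∀ n : ℤ, IsOfFinAddOrder (EtaleThetaDataOfSetting.pairRho C α β hφ hAβ hH (τ n) - τ (-n)))
    (hfree : ∀ m n : ℤ, IsOfFinAddOrder (τ m - τ n) → m = n) :
    Literature.IUT.HodgeArakelov.Cor112_ii
      (thetaEvaluation C hC hS hl hp2 hpl hζ mods f hf hmods h15 L hZ hcharY hlim Env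
        (EtaleThetaDataOfSetting.pointedInversionOfPair C hC hS hcharY (setting C hC hS hl hp2 hpl hζ mods f hf)
          (ContinuousMulEquiv.refl _) rfl Env α hover δ hδ hαα γ hγ hαγ huniq Dmu hDmu hfixD etaStd hmem hstd)
        (LevelRetraction.ofAugmentation (EtaleThetaDataOfSetting.phi C) (D.lDeltaTheta l)
          (EtaleThetaDataOfSetting.aug C) Dmu hDq (EtaleThetaDataOfSetting.PiYdd C)
          (EtaleThetaDataOfSetting.continuous_aug C) (aug_ker_acts_trivially C) hlift hemb)
        cU (EtaleThetaDataOfSetting.isOpen_stabilizer_units C) (EtaleThetaDataOfSetting.finiteIndex_stabilizer_units C)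
        Uu (EtaleThetaDataOfSetting.pairRhoLim C α β hφ hAβ hH)) :=
  cor112_ii_model C hC hS hl hp2 hpl hζ mods f hf hmods h15 L hZ hcharY hlim Env α hover δ hδ hαα γ hγ hαγ huniq Dmu hDmu
    hfixD etaStd hmem hstd β hφ hAβ hH hDq hlift hemb cU Uu hα hβ hfix
    (mem_thetaEvaluation_MxTM_of_isOfFinAddOrder C hC hS hl hp2 hpl hζ mods f hf hmods h15 L hZ hcharY hlim Env
      (EtaleThetaDataOfSetting.pointedInversionOfPair C hC hS hcharY (setting C hC hS hl hp2 hpl hζ mods f hf)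
        (ContinuousMulEquiv.refl _) rfl Env α hover δ hδ hαα γ hγ hαγ huniq Dmu hDmu hfixD etaStd hmem hstd)
      (LevelRetraction.ofAugmentation (EtaleThetaDataOfSetting.phi C) (D.lDeltaTheta l)
        (EtaleThetaDataOfSetting.aug C) Dmu hDq (EtaleThetaDataOfSetting.PiYdd C)
        (EtaleThetaDataOfSetting.continuous_aug C) (aug_ker_acts_trivially C) hlift hemb)
      cU (EtaleThetaDataOfSetting.isOpen_stabilizer_units C) (EtaleThetaDataOfSetting.finiteIndex_stabilizer_units C)
      Uu (EtaleThetaDataOfSetting.pairRhoLim C α β hφ hAβ hH) hcU hUu)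
    τ hτ hdesc hrev hfree

/-- **[IUTchII] Cor. 1.12 (ii) at the model with print's constants `U := 𝒪^×_{ℚ̄_p}`, `hμ` GONE.** As
`cor112_ii_model_of_bijective` at `Uu := unitGroup ℚ_[p] (PadicAlgCl p)` (abc-iut-L4's `𝒪^×_{k̄} ≤ k̄ˣ`, [AbsTopIII] Def. 3.1
(i)): the input `hUu` is the theorem `mem_unitGroup_padic_of_isOfFinOrder` (roots of unity are units of the ring of
integers), so the only input replacing `hμ` is `hcU`, the bijectivity of the cyclotomic rigidity datum
`Λ(ℚ̄_pˣ) = Ẑ(1) → (l·Δ_Θ)` (Cor. 1.11 (a)). Residual named print inputs: Rmk. 1.4.1 (ii) data of the pointed inversion,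
`hDq`/`hlift`/`hemb`, `hα`/`hβ`, `hfix`, the Prop. 2.2 (ii) translate inputs `τ`/`hτ`/`hdesc`/`hrev`/`hfree`, `hcU`.
[claim: Mochizuki2012, status: disputed] (IUTchII §1 Cor 1.12 (ii), kurims pp.56-58) -/
theorem cor112_ii_model_unitGroup (hcU : Function.Bijective cU.hom)
    (hα : ∀ x, EtaleThetaDataOfSetting.aug C (α x) = EtaleThetaDataOfSetting.aug C x)
    (hβ : ∀ a : D.GtpTheta, a ∈ D.lDeltaTheta l → β a = a)
    (hfix : ∀ K' : Subgroup (EtaleThetaDataOfSetting.Pi C), K'.FiniteIndex →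
      ∀ a : D.lDeltaTheta l, (∀ n : EtaleThetaDataOfSetting.Pi C, n ∈ EtaleThetaDataOfSetting.PiYdd C ⊓ K' →
        MulAut.conjNormal (EtaleThetaDataOfSetting.phi C n) a = a) → a = 1)
    (τ : ℤ → (EtaleThetaDataOfSetting.coh C).H1 ⊤) (hτ : τ 0 = etaStd)
    (hdesc : ∀ o ∈ EtaleThetaDataOfSetting.orbitOne C hC,
      ∃ (n : ℤ) (c' : (EtaleThetaDataOfSetting.coh C).H1 ⊤), 2 • c' = 0 ∧ o = τ n + c')
    (hrev : ∀ n : ℤ, IsOfFinAddOrder (EtaleThetaDataOfSetting.pairRho C α β hφ hAβ hH (τ n) - τ (-n)))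
    (hfree : ∀ m n : ℤ, IsOfFinAddOrder (τ m - τ n) → m = n) :
    Literature.IUT.HodgeArakelov.Cor112_ii
      (thetaEvaluation C hC hS hl hp2 hpl hζ mods f hf hmods h15 L hZ hcharY hlim Env
        (EtaleThetaDataOfSetting.pointedInversionOfPair C hC hS hcharY (setting C hC hS hl hp2 hpl hζ mods f hf)
          (ContinuousMulEquiv.refl _) rfl Env α hover δ hδ hαα γ hγ hαγ huniq Dmu hDmu hfixD etaStd hmem hstd)
        (LevelRetraction.ofAugmentation (EtaleThetaDataOfSetting.phi C) (D.lDeltaTheta l)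
          (EtaleThetaDataOfSetting.aug C) Dmu hDq (EtaleThetaDataOfSetting.PiYdd C)
          (EtaleThetaDataOfSetting.continuous_aug C) (aug_ker_acts_trivially C) hlift hemb)
        cU (EtaleThetaDataOfSetting.isOpen_stabilizer_units C) (EtaleThetaDataOfSetting.finiteIndex_stabilizer_units C)
        (unitGroup ℚ_[p] (PadicAlgCl p)) (EtaleThetaDataOfSetting.pairRhoLim C α β hφ hAβ hH)) :=
  cor112_ii_model_of_bijective C hC hS hl hp2 hpl hζ mods f hf hmods h15 L hZ hcharY hlim Env α hover δ hδ hαα γ hγ hαγ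
    huniq Dmu hDmu hfixD etaStd hmem hstd β hφ hAβ hH hDq hlift hemb cU (unitGroup ℚ_[p] (PadicAlgCl p)) hcU
    (fun _ hu => mem_unitGroup_padic_of_isOfFinOrder hu) hα hβ hfix τ hτ hdesc hrev hfree

end Model

end EtaleLevels

end Literature.IUT.HodgeArakelov
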